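import Mathlib
import Summits.Ventures.HodgeRepro.Tier4.Target
import Summits.Ventures.HodgeRepro.Tier4.Line3.Defs
import Summits.Ventures.HodgeRepro.Tier4.Line3.KMDatum
import Summits.Ventures.HodgeRepro.Tier4.Line3.KMDatumS
import Summits.Ventures.HodgeRepro.Tier4.Line3.CopyWeightGaussian
import Summits.Ventures.HodgeRepro.Tier4.Line3.CopyWeightBoundShrinkRed
import Summits.Ventures.HodgeRepro.Tier4.Line3.CopyCountRay
import Summits.Ventures.HodgeRepro.Tier4.Line3.HKRayReduction
import Summits.Ventures.HodgeRepro.Tier4.Line3.DatumOrthVanishing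
import Summits.Ventures.HodgeRepro.Tier4.Line3.Transvection
import Summits.Ventures.HodgeRepro.Tier4.Line3.KMKernelForm
import Summits.Ventures.HodgeRepro.Tier4.Line3.KMDilation

/-!
# Tier4/Line3/KMLaplace — the datum-free dilation comparison from ONE-parameter Laplace bounds

Blind re-derivation cell `pub-hodge-repro`, Tier 4 «PROVE THE STEP», LINE L3, seat t4-x2 (g4, reserve wall-breaker),
cut C-L3-HKRAY: the last reduction of the analysis (HKRAY-x2.md §5) to two displayed Laplace bounds.

For the explicit Kudla–Millson integrand `kmDilInt xm α β = P_KM · e^{−π(α m_0 + β m_1)}` at a symmetric centre, the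
two-parameter comparison `KMDilationComparison X xm A k` follows from the ONE-parameter function
`J(μ) := ∫_𝔹 P_KM e^{−π μ (m_0 + m_1)}` (`kmJ`) and two polynomial bounds: `J(μ) ≤ C (μ^{−4} + μ^{−p})` for all `μ > 0`
(`KMLaplaceUpper`, with the integrability of every `kmDilInt xm α β`, `α, β > 0`) and `J(ν) ≥ c ν^{−4}` for `ν ≥ 1`
(`KMLaplaceLower`, under that integrability).  Mechanism: `e^{−π(λa m_0 + λb m_1)} ≤ e^{−π λ min(a,b) (m_0+m_1)}` since `m_j ≥ 0` on the ball
(`tauSize_le_maj`) and `P_KM ≥ 0`, so `I(λa, λb) ≤ J(λ min(a,b))`; then with `μ := λ min(a,b) ≤ ν := 2λ` and `p ≥ 4`,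
`C(μ^{−4} + μ^{−p}) ≤ (2C/c)(ν/μ)^p · c ν^{−4} ≤ (2C/c)(2/a)^p(2/b)^p J(ν)` (`kmDilationComparison_of_laplace`).
The two bounds are the Laplace analysis at `z*` (interior exponent `4` = real dimension of the ball, `P_KM ≍ |f_0 f_1|²`)
and at the boundary (`m_0 + m_1 → ∞`, polynomial growth `g^{−7}`): HKRAY-x2.md §5, `p = 7` crude; NOT typed here.

Nothing here says anything about the status of the Hodge conjecture for CM abelian varieties, which is NOT proved
(HC_CM is NOT proved by anyone in this repository).
-/

set_option autoImplicit false

noncomputable section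

namespace Summit.Ventures.HodgeRepro.Tier4.Line3

open Summit.Ventures.HodgeRepro.Tier4
open MeasureTheory

namespace T4Data

variable (X : T4Data)

/-- The one-parameter Laplace integral `J(μ) := ∫_𝔹 P_KM e^{−π μ (m_0 + m_1)}`. -/
def kmJ (xm : X.Tuple) (μ : ℝ) : ℝ := ∫ z in ball, X.kmDilInt xm μ μ z

/-- **THE UPPER LAPLACE BOUND** (DISPLAYED): every `kmDilInt xm α β`, `α, β > 0`, is integrable on the ball, and
`J(μ) ≤ C (μ^{−4} + μ^{−p})` for all `μ > 0`. -/
def KMLaplaceUpper (xm : X.Tuple) (C p : ℝ) : Prop :=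
  (∀ α β : ℝ, 0 < α → 0 < β → IntegrableOn (X.kmDilInt xm α β) ball) ∧
  ∀ μ : ℝ, 0 < μ → X.kmJ xm μ ≤ C * (μ ^ (-4 : ℝ) + μ ^ (-p))

/-- **THE LOWER LAPLACE BOUND** (DISPLAYED): `J(ν) ≥ c ν^{−4}` for `ν ≥ 1` (given the integrability of the integrand
on the ball, which is `KMLaplaceUpper`'s clause). -/
def KMLaplaceLower (xm : X.Tuple) (c : ℝ) : Prop :=
  ∀ ν : ℝ, 1 ≤ ν → IntegrableOn (X.kmDilInt xm ν ν) ball → c * ν ^ (-4 : ℝ) ≤ X.kmJ xm ν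

/-- The reduced majorant is non-negative on the ball. -/
theorem redMaj_nonneg (xm : X.Tuple) (j : Fin 4) {z : Fin 2 → ℂ} (hz : z ∈ ball) : 0 ≤ X.redMaj xm j z := by
  unfold redMaj
  linarith [X.tauSize_le_maj (xm j) hz]

/-- The KM Gaussian-free part is non-negative at a symmetric centre. -/
theorem kmGaussFree_nonneg (xm : X.Tuple) (h02 : xm 2 = xm 0) (h13 : xm 3 = xm 1) (z : Fin 2 → ℂ) :
    0 ≤ X.kmGaussFree xm z := by
  unfold kmGaussFree
  refine mul_nonneg ?_ (Real.exp_pos _).le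
  rw [X.kmKernel_symm xm h02 h13, Complex.ofReal_re]
  exact mul_nonneg (mul_nonneg (div_nonneg (Complex.normSq_nonneg _) (Even.pow_nonneg (by decide) _))
    (Complex.normSq_nonneg _)) (Real.exp_pos _).le

/-- The KM integrand is non-negative at a symmetric centre. -/
theorem kmDilInt_nonneg (xm : X.Tuple) (h02 : xm 2 = xm 0) (h13 : xm 3 = xm 1) (α β : ℝ) (z : Fin 2 → ℂ) :
    0 ≤ X.kmDilInt xm α β z :=
  mul_nonneg (X.kmGaussFree_nonneg xm h02 h13 z) (Real.exp_pos _).le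

/-- **MONOTONICITY IN THE PARAMETERS** on the ball: `α' ≤ α`, `β' ≤ β` ⇒ `kmDilInt α β ≤ kmDilInt α' β'`. -/
theorem kmDilInt_mono (xm : X.Tuple) (h02 : xm 2 = xm 0) (h13 : xm 3 = xm 1) {α β α' β' : ℝ} (hα : α' ≤ α)
    (hβ : β' ≤ β) {z : Fin 2 → ℂ} (hz : z ∈ ball) : X.kmDilInt xm α β z ≤ X.kmDilInt xm α' β' z := by
  unfold kmDilInt
  refine mul_le_mul_of_nonneg_left (Real.exp_le_exp.2 ?_) (X.kmGaussFree_nonneg xm h02 h13 z)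
  have h0 := X.redMaj_nonneg xm 0 hz
  have h1 := X.redMaj_nonneg xm 1 hz
  nlinarith [Real.pi_pos, mul_le_mul_of_nonneg_right hα h0, mul_le_mul_of_nonneg_right hβ h1]

/-- `(2/a)(2/b) ≥ 2/min(a,b)` on `(0,2]²`, raised to a power `p ≥ 0`. -/
theorem two_div_min_rpow_le {a b p : ℝ} (ha0 : 0 < a) (ha2 : a ≤ 2) (hb0 : 0 < b) (hb2 : b ≤ 2) (hp : 0 ≤ p) :
    (2 / min a b) ^ p ≤ (2 / a) ^ p * (2 / b) ^ p := by
  rw [← Real.mul_rpow (by positivity) (by positivity)]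
  refine Real.rpow_le_rpow (by positivity) ?_ hp
  rcases le_total a b with hab | hab
  · rw [min_eq_left hab]
    have : 1 ≤ 2 / b := by rw [le_div_iff₀ hb0]; linarith
    calc 2 / a = 2 / a * 1 := by ring
      _ ≤ 2 / a * (2 / b) := by gcongr
  · rw [min_eq_right hab]
    have : 1 ≤ 2 / a := by rw [le_div_iff₀ ha0]; linarith
    calc 2 / b = 1 * (2 / b) := by ring
      _ ≤ 2 / a * (2 / b) := by gcongr

/-- **THE DATUM-FREE COMPARISON FROM THE TWO LAPLACE BOUNDS**: `KMDilationComparison X xm (2C/c) p` for `p ≥ 4`. -/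
theorem kmDilationComparison_of_laplace (xm : X.Tuple) (h02 : xm 2 = xm 0) (h13 : xm 3 = xm 1) {C p c : ℝ}
    (hp : 4 ≤ p) (hU : X.KMLaplaceUpper xm C p) (hc : 0 < c) (hL : X.KMLaplaceLower xm c) :
    X.KMDilationComparison xm (2 * C / c) p := by
  obtain ⟨hint, hup⟩ := hU
  intro lam hlam a b ha0 ha2 hb0 hb2
  have hm0 : 0 < min a b := lt_min ha0 hb0
  have hlam0 : 0 < lam := by linarith
  set μ : ℝ := lam * min a b with hμ
  set ν : ℝ := 2 * lam with hν
  have hμ0 : 0 < μ := by rw [hμ]; positivity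
  have hν1 : 1 ≤ ν := by rw [hν]; linarith
  have hμν : μ ≤ ν := by
    rw [hμ, hν]
    have : min a b ≤ 2 := (min_le_left a b).trans ha2
    nlinarith
  refine ⟨hint _ _ (by positivity) (by positivity), ?_⟩
  -- monotonicity: `I(λa, λb) ≤ J(μ)`
  have hmono : ∫ z in ball, X.kmDilInt xm (lam * a) (lam * b) z ≤ X.kmJ xm μ := by
    unfold kmJ
    refine setIntegral_mono_on (hint _ _ (by positivity) (by positivity)) (hint _ _ hμ0 hμ0) measurableSet_ball_nsq
      fun z hz => ?_
    refine X.kmDilInt_mono xm h02 h13 ?_ ?_ hz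
    · rw [hμ]; exact mul_le_mul_of_nonneg_left (min_le_left a b) hlam0.le
    · rw [hμ]; exact mul_le_mul_of_nonneg_left (min_le_right a b) hlam0.le
  have hJν : c * ν ^ (-4 : ℝ) ≤ X.kmJ xm ν := hL ν hν1 (hint ν ν (by linarith) (by linarith))
  have hJμ : X.kmJ xm μ ≤ C * (μ ^ (-4 : ℝ) + μ ^ (-p)) := hup μ hμ0
  have hJν0 : 0 ≤ X.kmJ xm ν := integral_nonneg fun z => X.kmDilInt_nonneg xm h02 h13 _ _ z
  have hC0 : 0 ≤ C := by
    have h1 := hup 1 one_pos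
    have h2 : 0 ≤ X.kmJ xm 1 := integral_nonneg fun z => X.kmDilInt_nonneg xm h02 h13 _ _ z
    have h3 : (1 : ℝ) ^ (-4 : ℝ) + 1 ^ (-p) = 2 := by simp; norm_num
    rw [h3] at h1
    linarith
  have hp0 : 0 ≤ p := by linarith
  -- the constants: `C (μ^{-4} + μ^{-p}) ≤ (2C/c) (ν/μ)^p · c ν^{-4}`
  have hkey : C * (μ ^ (-4 : ℝ) + μ ^ (-p)) ≤ 2 * C / c * (ν / μ) ^ p * (c * ν ^ (-4 : ℝ)) := by
    have hν0 : 0 < ν := by linarith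
    have e0 : μ ^ (-4 : ℝ) = μ ^ (p - 4) * μ ^ (-p) := by
      rw [← Real.rpow_add hμ0]
      congr 1
      ring
    have e1 : μ ^ (p - 4) ≤ ν ^ (p - 4) := Real.rpow_le_rpow hμ0.le hμν (by linarith)
    have e2 : (1 : ℝ) ≤ ν ^ (p - 4) := Real.one_le_rpow hν1 (by linarith)
    have e3 : (ν / μ) ^ p * ν ^ (-4 : ℝ) = ν ^ (p - 4) * μ ^ (-p) := by
      rw [Real.div_rpow hν0.le hμ0.le, Real.rpow_neg hν0.le, Real.rpow_neg hμ0.le, Real.rpow_sub hν0]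
      have h1 : ν ^ (4 : ℝ) ≠ 0 := (Real.rpow_pos_of_pos hν0 _).ne'
      have h2 : μ ^ p ≠ 0 := (Real.rpow_pos_of_pos hμ0 _).ne'
      field_simp
    have hμp : 0 ≤ μ ^ (-p) := Real.rpow_nonneg hμ0.le _
    calc C * (μ ^ (-4 : ℝ) + μ ^ (-p)) = C * (μ ^ (p - 4) * μ ^ (-p) + 1 * μ ^ (-p)) := by rw [e0]; ring
      _ ≤ C * (ν ^ (p - 4) * μ ^ (-p) + ν ^ (p - 4) * μ ^ (-p)) := by gcongr
      _ = 2 * C * ((ν / μ) ^ p * ν ^ (-4 : ℝ)) := by rw [e3]; ring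
      _ = 2 * C / c * (ν / μ) ^ p * (c * ν ^ (-4 : ℝ)) := by field_simp
  have hνμ : ν / μ = 2 / min a b := by
    rw [hν, hμ]
    field_simp
  have hpow : (ν / μ) ^ p ≤ (2 / a) ^ p * (2 / b) ^ p := by
    rw [hνμ]
    exact two_div_min_rpow_le ha0 ha2 hb0 hb2 hp0
  have hA0 : 0 ≤ 2 * C / c := by positivity
  calc ∫ z in ball, X.kmDilInt xm (lam * a) (lam * b) z ≤ X.kmJ xm μ := hmono
    _ ≤ C * (μ ^ (-4 : ℝ) + μ ^ (-p)) := hJμ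
    _ ≤ 2 * C / c * (ν / μ) ^ p * (c * ν ^ (-4 : ℝ)) := hkey
    _ ≤ 2 * C / c * (ν / μ) ^ p * X.kmJ xm ν := by gcongr
    _ ≤ 2 * C / c * ((2 / a) ^ p * (2 / b) ^ p) * X.kmJ xm ν := by gcongr
    _ = 2 * C / c * (2 / a) ^ p * (2 / b) ^ p * ∫ z in ball, X.kmDilInt xm (2 * lam) (2 * lam) z := by
        unfold kmJ
        ring

/-- **THE CUT FROM THE TWO LAPLACE BOUNDS**: `hkRed_ray` for every `D : X.ThetaData` from `KMLaplaceUpper` and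
`KMLaplaceLower` at the centre. -/
theorem hkRed_ray_of_laplace (D : X.ThetaData) (xm : X.Tuple) (h02 : xm 2 = xm 0) (h13 : xm 3 = xm 1)
    (hlap : ∃ C p c : ℝ, 4 ≤ p ∧ X.KMLaplaceUpper xm C p ∧ 0 < c ∧ X.KMLaplaceLower xm c) :
    ∃ A k : ℝ, 0 ≤ A ∧ 0 ≤ k ∧ ∀ n : ℕ, 1 ≤ n → X.MajorantMomentBoundRed D (X.rayCentre xm n) A k := by
  obtain ⟨C, p, c, hp, hU, hc, hL⟩ := hlap
  have hC0 : 0 ≤ C := by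
    obtain ⟨_, hup⟩ := hU
    have h1 := hup 1 one_pos
    have h2 : 0 ≤ X.kmJ xm 1 := integral_nonneg fun z => X.kmDilInt_nonneg xm h02 h13 _ _ z
    have h3 : (1 : ℝ) ^ (-4 : ℝ) + 1 ^ (-p) = 2 := by simp; norm_num
    rw [h3] at h1
    linarith
  exact X.hkRed_ray_of_exists_kmDilationComparison D xm h02 h13
    ⟨2 * C / c, p, by positivity, by linarith, X.kmDilationComparison_of_laplace xm h02 h13 hp hU hc hL⟩

end T4Data

end Summit.Ventures.HodgeRepro.Tier4.Line3

end
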